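import Literature.Computability.Complexity.FoldBricks
import Literature.Computability.Complexity.StackNumeric
import Literature.Computability.QuantumComplexity.RevTableauUniform
import HarnessLib

/-!
# Printing the description of a block swap in polynomial time

Trunk `CryptoQuantFine`; uniformity companion of `RevMultiplex.lean` / `WireConjugation.lean`
for swap layers whose second block starts at a *data-dependent* offset: the wrapped family of
`CWrapLayout.lean` conjugates the copy of length `ℓ` by the swap of the front window `[0, K)`
with block `ℓ` at `base = baseB + ℓ·K`, and between the two swaps it prints the given family's
description verbatim — so this swap cannot come out of the one generator program of the other
gadgets (`RevMultiplexGen.lean`), it is printed at the string level: **the description bits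
`(RevMux.swapOps [(i, base + i) | i < K]).flatMap opBits` as an `FP` function of
`⟨bin base, 1ᴷ⟩`** (`swapDescFn`, `swapDescFn_apply`, `swapDescFn_mem_FP`), by the counted
concatenation fold of `FoldBricks.lean` over the pieces "three `CNOT` words on wires
`(i, base + i)`" (`cnotBitsFn`: the `gateBits 3 2 [p, q]` of `RevTableauUniform.lean`, built
from `boolPair`s since `wireBits p ++ wireBits q = dbl (⟨bin p, []⟩ ++ ⟨bin q, []⟩)`).
(Arora–Barak 2009, §6.1: descriptions of circuits; §1.3.)

## References

* S. Arora, B. Barak, *Computational Complexity: A Modern Approach*, CUP 2009, §6.1, §1.3.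
* M. A. Nielsen, I. L. Chuang, *Quantum Computation and Quantum Information*, CUP 2010, §1.3.4.
-/

noncomputable section

namespace Literature.Computability.QuantumComplexity

open _root_.Computability Polynomial Complexity Complexity.Brick Plumb RevDesc SProg

namespace SwapDesc

/-! ### The bits of one `CNOT` word -/

/-- Two wire fields: `wireBits p ++ wireBits q = dbl (⟨bin p, []⟩ ++ ⟨bin q, []⟩)`. [folklore] -/
theorem wireBits_append_wireBits (p q : ℕ) :
    wireBits p ++ wireBits q = dbl (boolPair (encodeNat p) [] ++ boolPair (encodeNat q) []) := by
  rw [RevDesc.boolPair_eq, RevDesc.boolPair_eq]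
  simp [wireBits, dbl_dbl_encodeNat, List.append_assoc]

/-- **The bits of `CNOT p q` in a circuit description**: `gatePre 3 2 ++ ⟨⟨bin p, []⟩ ++ ⟨bin q, []⟩, []⟩`.
[cite: AroraBarak2009, §6.1 (descriptions of circuits)] -/
theorem opBits_cnot (p q : ℕ) :
    opBits (ClOp.cnot p q) = gatePre 3 2 ++ boolPair (boolPair (encodeNat p) [] ++ boolPair (encodeNat q) []) [] := by
  have h1 : opBits (ClOp.cnot p q) = gateBits 3 2 [p, q] := by simp [opBits, agates, AGate.bits, symCode, symArity]
  have h2 : ([p, q] : List ℕ).flatMap wireBits = wireBits p ++ wireBits q := by simp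
  rw [h1, gateBits, h2, wireBits_append_wireBits,
    RevDesc.boolPair_eq (boolPair (encodeNat p) [] ++ boolPair (encodeNat q) []) ([] : List Bool), List.append_nil,
    List.append_assoc]

/-- The string function `⟨a, b⟩ ↦ gatePre 3 2 ++ ⟨⟨a, []⟩ ++ ⟨b, []⟩, []⟩`. [folklore] -/
def cnotBitsFn : List Bool → List Bool :=
  appF ∘ fanoutFn (fun _ => gatePre 3 2)
    (fanoutFn (appF ∘ fanoutFn (fanoutFn fstF (fun _ => [])) (fanoutFn sndF (fun _ => []))) (fun _ => []))

/-- Value of `cnotBitsFn` on numerals: the bits of the `CNOT` word. [folklore] -/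
theorem cnotBitsFn_apply (p q : ℕ) : cnotBitsFn (boolPair (encodeNat p) (encodeNat q)) = opBits (ClOp.cnot p q) := by
  rw [opBits_cnot]
  simp [cnotBitsFn, fanoutFn_apply]

/-- `cnotBitsFn ∈ FP`. [folklore] -/
theorem cnotBitsFn_mem_FP : cnotBitsFn ∈ FP :=
  comp_mem_FP appF_mem_FP (fanoutFn_mem_FP (const_mem_FP _)
    (fanoutFn_mem_FP (comp_mem_FP appF_mem_FP (fanoutFn_mem_FP (fanoutFn_mem_FP fstF_mem_FP (const_mem_FP _))
      (fanoutFn_mem_FP sndF_mem_FP (const_mem_FP _)))) (const_mem_FP _)))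

/-- Length of `cnotBitsFn ⟨a, b⟩`: linear in `|a| + |b|`. [folklore] -/
theorem length_cnotBitsFn (a b : List Bool) :
    (cnotBitsFn (boolPair a b)).length = (gatePre 3 2).length + (4 * a.length + 4 * b.length + 10) := by
  simp [cnotBitsFn, fanoutFn_apply, appF, fstF, sndF, boolUnpair_boolPair, length_boolPair]
  ring

/-- The three words of one swapped pair `(p, q)`: `CNOT p q; CNOT q p; CNOT p q`. [cite: NielsenChuang2010, §1.3.4 (swap from three CNOTs)] -/
def swapBitsFn : List Bool → List Bool :=
  appF ∘ fanoutFn cnotBitsFn (appF ∘ fanoutFn (cnotBitsFn ∘ fanoutFn sndF fstF) cnotBitsFn)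

/-- Value of `swapBitsFn` on numerals. [folklore] -/
theorem swapBitsFn_apply (p q : ℕ) :
    swapBitsFn (boolPair (encodeNat p) (encodeNat q)) =
      opBits (ClOp.cnot p q) ++ (opBits (ClOp.cnot q p) ++ opBits (ClOp.cnot p q)) := by
  simp [swapBitsFn, fanoutFn_apply, cnotBitsFn_apply, appF, fstF, sndF, boolUnpair_boolPair]

/-- `swapBitsFn ∈ FP`. [folklore] -/
theorem swapBitsFn_mem_FP : swapBitsFn ∈ FP :=
  comp_mem_FP appF_mem_FP (fanoutFn_mem_FP cnotBitsFn_mem_FP (comp_mem_FP appF_mem_FP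
    (fanoutFn_mem_FP (comp_mem_FP cnotBitsFn_mem_FP (fanoutFn_mem_FP sndF_mem_FP fstF_mem_FP)) cnotBitsFn_mem_FP)))

/-! ### The piece function and the fold -/

/-- The piece of index `i` on the context `x = ⟨bin base, 1ᴷ⟩`: the three words of the pair
`(i, base + i)` (the index arrives as `1ⁱ`). [folklore] -/
def pieceFn : List Bool → List Bool :=
  swapBitsFn ∘ fanoutFn (lenBinF ∘ sndF) (addFn ∘ fanoutFn (fstF ∘ fstF) (lenBinF ∘ sndF))

/-- Value of the piece. [folklore] -/
theorem pieceFn_apply (b u : List Bool) (i : ℕ) :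
    pieceFn (boolPair (boolPair b u) (ones i)) =
      opBits (ClOp.cnot i (bitsToNat b + i)) ++ (opBits (ClOp.cnot (bitsToNat b + i) i) ++ opBits (ClOp.cnot i (bitsToNat b + i))) := by
  simp [pieceFn, fanoutFn_apply, ones, swapBitsFn_apply]

/-- `pieceFn ∈ FP`. [folklore] -/
theorem pieceFn_mem_FP : pieceFn ∈ FP :=
  comp_mem_FP swapBitsFn_mem_FP (fanoutFn_mem_FP (comp_mem_FP lenBinF_mem_FP sndF_mem_FP)
    (comp_mem_FP addFn_mem_FP (fanoutFn_mem_FP (comp_mem_FP fstF_mem_FP fstF_mem_FP) (comp_mem_FP lenBinF_mem_FP sndF_mem_FP))))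

/-- Length of the bits of a `CNOT` word. [folklore] -/
theorem length_opBits_cnot (p q : ℕ) :
    (opBits (ClOp.cnot p q)).length = (gatePre 3 2).length + (4 * (encodeNat p).length + 4 * (encodeNat q).length + 10) := by
  rw [← cnotBitsFn_apply, length_cnotBitsFn]

/-- The clipping constant: every actual piece is this short in the context. [folklore] -/
def clipC : ℕ := 3 * (gatePre 3 2).length + 42

/-- **Actual pieces are short**: for `i ≤ K = |u|`, the piece has length `≤ clipC · (|⟨b, u⟩| + 1)`.
[folklore] -/
theorem length_pieceFn_le (b u : List Bool) {i : ℕ} (hi : i ≤ u.length) :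
    (pieceFn (boolPair (boolPair b u) (ones i))).length ≤ clipC * ((boolPair b u).length + 1) := by
  have h1 : (encodeNat i).length ≤ u.length := (length_encodeNat_le_self i).trans hi
  have h2 : (encodeNat (bitsToNat b + i)).length ≤ b.length + u.length + 1 := by
    have h := length_encodeNat_add_le b (encodeNat i)
    rw [bitsToNat_encodeNat] at h
    omega
  rw [pieceFn_apply, List.length_append, List.length_append, length_opBits_cnot, length_opBits_cnot,
    length_boolPair, clipC]
  have h3 : 0 ≤ (gatePre 3 2).length := Nat.zero_le _
  nlinarith [h1, h2, h3, Nat.zero_le b.length, Nat.zero_le u.length]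

/-- **The swap-description function**: on `⟨bin base, 1ᴷ⟩`, fold the pieces `i = 0, …, K-1` by
concatenation (`foldLoop appF`, `K` rounds, countdown `bin K`), then read off the accumulator.
[cite: AroraBarak2009, §1.3 (bounded loops)] -/
def swapDescFn : List Bool → List Bool :=
  sndPow 2 ∘ foldLoop appF (clipF clipC pieceFn) X ∘
    fanoutFn (fun w => w) (fanoutFn (lenBinF ∘ sndF) (fun _ => boolPair [] []))

/-- `swapDescFn ∈ FP`. [folklore] -/
theorem swapDescFn_mem_FP : swapDescFn ∈ FP :=
  comp_mem_FP (sndPow_mem_FP 2) (comp_mem_FP (foldLoop_clipF_mem_FP clipC appF_mem_FP length_appF_le pieceFn_mem_FP X)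
    (fanoutFn_mem_FP (PolyTimeComputable.id _) (fanoutFn_mem_FP (comp_mem_FP lenBinF_mem_FP sndF_mem_FP) (const_mem_FP _))))

/-- The description bits of the swap of `[0, K)` with `[base, base + K)`, as a `ccat`. [folklore] -/
theorem flatMap_opBits_swapOps_eq_ccat (base : ℕ) : ∀ K : ℕ,
    (((List.range K).map fun i => (i, base + i)).flatMap fun p =>
        [ClOp.cnot p.1 p.2, ClOp.cnot p.2 p.1, ClOp.cnot p.1 p.2]).flatMap opBits =
      ccat (fun i => opBits (ClOp.cnot i (base + i)) ++ (opBits (ClOp.cnot (base + i) i) ++ opBits (ClOp.cnot i (base + i)))) K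
  | 0 => rfl
  | K + 1 => by
    rw [List.range_succ, List.map_append, List.flatMap_append, List.flatMap_append,
      flatMap_opBits_swapOps_eq_ccat base K, ccat_succ]
    simp

/-- **`swapDescFn ⟨bin base, 1ᴷ⟩` is the description of the swap layer on the pairs
`(i, base + i)`, `i < K`.** [cite: AroraBarak2009, §6.1 (descriptions of circuits)] -/
theorem swapDescFn_apply (base K : ℕ) :
    swapDescFn (boolPair (encodeNat base) (ones K)) =
      (((List.range K).map fun i => (i, base + i)).flatMap fun p =>
        [ClOp.cnot p.1 p.2, ClOp.cnot p.2 p.1, ClOp.cnot p.1 p.2]).flatMap opBits := by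
  rw [flatMap_opBits_swapOps_eq_ccat]
  have h0 : fanoutFn (fun w => w) (fanoutFn (lenBinF ∘ sndF) (fun _ => boolPair [] [])) (boolPair (encodeNat base) (ones K)) =
      boolPair (boolPair (encodeNat base) (ones K)) (boolPair (encodeNat K) (boolPair (ones 0) [])) := by
    simp [fanoutFn_apply, ones]
  rw [swapDescFn, Function.comp_apply, Function.comp_apply, h0,
    foldLoop_apply appF (clipF clipC pieceFn) (by simp [ones]) 0 [],
    sndPow_succ_boolPair, sndPow_succ_boolPair, sndPow_zero_boolPair,
    foldAcc_clipF (fun j _ hj => length_pieceFn_le _ _ (by simp [ones] at hj ⊢; omega)), foldAcc_appF]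
  rw [List.nil_append]
  refine ccat_congr fun j _ => ?_
  rw [Nat.zero_add, pieceFn_apply, bitsToNat_encodeNat]

end SwapDesc

end Literature.Computability.QuantumComplexity

end
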